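import Summits.AtomisticToContinuum.Crystallization.Theorems.FrustratedLawDichotomyStrainedPatchHomEntryFlipHcpKit

/-!
# SYMMETRY REDUCTION of the hcp half of `(H)`, part 2: the FUNDAMENTAL DOMAIN `ξ₀ ≥ 0`, `ξ₂ ≥ 0` (×4) and the certificate theorems over it

decomp-a2c hand-2 g23 (crux `AperiodicFrustratedLawGap`, stmt-AtomisticToContinuum-27623; sequel of `…HomEntryFlipHcpKit`, the hcp twin of hand-1 g21's
`…HomEntrySign`).  `F₀` flips the sign of `ξ₀` and leaves `ξ₂` alone, `F₂` flips `ξ₂` and leaves `ξ₀` alone; the transfer `dichotomy_of_flipH` of part 1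
therefore reduces the hcp dichotomy for ALL `(U, ξ)` (`U` self-adjoint positive, `‖U − 1‖ ≤ 1/4`, `‖ξ‖ ≤ 1/4`) to the quarter `ξ₀ ≥ 0`, `ξ₂ ≥ 0` of the
shuffle cube — the hcp search visits ≈ 1/4 of the entry/shuffle cube (plus boundary boxes).

* §5 ★★ `hcpHalf_of_shufSigned` (the reduction);
* §6 the vacuous-leaf verdict `shufOut` (box has `ξ₀ < 0` or `ξ₂ < 0` throughout), `entryLeafOKH3RD μ := shufOut ∨ entryLeafOKH3R μ`
  (sign ∨ radial ∨ sharp fit ∨ fit ∨ symmetry ∨ column ∨ (P4), nine free coordinates), ★★ the generic domain-relative tree / search theorems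
  `hcpHalf_of_entryTreeShuf` / `hcpHalf_of_entrySearchShuf`, and the instance `hcpHalf_of_entrySearchH3RD`;
* §7 ★★★ `homFloor_of_entrySearches6R3RD` (fcc `entryLeafOK6R` × hcp `entryLeafOKH3RD`), `…6RB3RD` (fcc `entryLeafOK6RB`), `1/625` and `1/1000` forms;
* §8 kernel smoke test.

One kernel definition + one verdict; 0 sorry; standard axioms; no instances / notation / `#eval`.  `--supports stmt-AtomisticToContinuum-27623`.
-/

namespace Summit.AtomisticToContinuum.Crystallization.Theorems.FrustratedLawDichotomyStrainedPatchHomEntryFlipHcp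

open scoped BigOperators RealInnerProductSpace
open Literature.Analysis.ValidatedNumerics.Numerics
open Summit.AtomisticToContinuum.Crystallization.Theorems.ChargedEnergyGapNegative (E3)
open Summit.AtomisticToContinuum.Crystallization.Theorems.FrustratedLawDichotomySchurCut (effPot w₄₅ ω₄)
open Summit.AtomisticToContinuum.Crystallization.Theorems.FrustratedLawDichotomyAveragingRuleTightFree (TightNearCap BadNearCap)
open Summit.AtomisticToContinuum.Crystallization.Theorems.FrustratedLawDichotomyExemptAbsorption (ExemptNear)
open Summit.AtomisticToContinuum.Crystallization.Theorems.FrustratedLawDichotomyStrainedPatchHomSplit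
open Summit.AtomisticToContinuum.Crystallization.Theorems.FrustratedLawDichotomyStrainedPatchHomCover (shuffle_mem_rootCube)
open Summit.AtomisticToContinuum.Crystallization.Theorems.FrustratedLawDichotomyStrainedPatchHomPrunedPolar (homFloor_of_prunedBoxSums_selfAdjoint)
open Summit.AtomisticToContinuum.Crystallization.Theorems.FrustratedLawDichotomyStrainedPatchHomCertTree (CertTree treeOK treeOK_sound)
open Summit.AtomisticToContinuum.Crystallization.Theorems.FrustratedLawDichotomyStrainedPatchHomEntryGram
open Summit.AtomisticToContinuum.Crystallization.Theorems.FrustratedLawDichotomyStrainedPatchHomEntryGramHcp (rootCH rootWH)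
open Summit.AtomisticToContinuum.Crystallization.Theorems.FrustratedLawDichotomyStrainedPatchHomEntryTable (muRec muRec_ok)
open Summit.AtomisticToContinuum.Crystallization.Theorems.FrustratedLawDichotomyStrainedPatchHomEntrySearch (searchOK exists_tree_of_searchOK)
open Summit.AtomisticToContinuum.Crystallization.Theorems.FrustratedLawDichotomyStrainedPatchHomEntrySix (muMilli muMilli_ok)
open Summit.AtomisticToContinuum.Crystallization.Theorems.FrustratedLawDichotomyStrainedPatchHomEntrySignKit
  (flipIso flipIso_apply conjIso_selfAdjoint conjIso_pos conjIso_norm_sub_one_le)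
open Summit.AtomisticToContinuum.Crystallization.Theorems.FrustratedLawDichotomyStrainedPatchHomEntryRadial (entryLeafOK6R fccHalf_of_entrySearch6R)
open Summit.AtomisticToContinuum.Crystallization.Theorems.FrustratedLawDichotomyStrainedPatchHomEntrySixHcpSharp (entryLeafOK6RB fccHalf_of_entrySearch6RB)
open Summit.AtomisticToContinuum.Crystallization.Theorems.FrustratedLawDichotomyStrainedPatchHomEntryRadialHcp (entryLeafOKH3R entryLeafOKH3R_sound)
open Summit.AtomisticToContinuum.Crystallization.Theorems.FrustratedLawDichotomyStrainedPatchHomEntryFlipHcpKit (dichotomy_of_flipH)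

/-! ## §5. The reduction to `ξ₀ ≥ 0`, `ξ₂ ≥ 0` -/

/-- The hcp dichotomy for the data `(U, ξ)` at floor `m`: prune disjunct ∨ box-sum floor (the body of the `hhcp` hypothesis of
`…HomPrunedPolar.homFloor_of_prunedBoxSums_selfAdjoint`). -/
def HcpDich (m : ℝ) (U : E3 →L[ℝ] E3) (ξ : E3) : Prop :=
  (∀ (M : ℕ) (z : Fin M → E3) (c : Fin M), Function.Injective z →
      Set.range z = {x : E3 | dist x (z c) ≤ 133 / 10 ∧ ∃ a : Fin 3 → ℤ,
        x = z c + latPt U hexFrame a ∨ x = z c + latPt U hexFrame a + U (hcpShift + ξ)} →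
      TightNearCap (9 / 5) (3 / 2) z c ∨ ExemptNear (9 / 5) ExRec z c ∨ BadNearCap (9 / 5) (3 / 2) z c) ∨
    m ≤ (∑ b ∈ (Fintype.piFinset fun _ : Fin 3 => Finset.Icc (-7 : ℤ) 7).filter (fun b => b ≠ 0),
        effPot w₄₅ ω₄ (3 / 400) ‖latPt U hexFrame b‖ +
      ∑ b ∈ (Fintype.piFinset fun _ : Fin 3 => Finset.Icc (-7 : ℤ) 7),
        effPot w₄₅ ω₄ (3 / 400) ‖latPt U hexFrame b + U (hcpShift + ξ)‖) / 2 - (-(7175 / 10000) + 3 / 400)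

/-- ★ One reflection step: the dichotomy for `(Fᵢ U Fᵢ, Fᵢ ξ)` gives it for `(U, ξ)` (`i ∈ {0,2}`). [folklore] -/
theorem hcpDich_of_flip {i : Fin 3} (hi : i = 0 ∨ i = 2) {m : ℝ} (U : E3 →L[ℝ] E3) (ξ : E3) (hU : ‖U - 1‖ ≤ 1 / 4) (hξ : ‖ξ‖ ≤ 1 / 4)
    (h : HcpDich m ((flipIso i : E3 →L[ℝ] E3).comp (U.comp ((flipIso i).symm : E3 →L[ℝ] E3))) (flipIso i ξ)) : HcpDich m U ξ :=
  dichotomy_of_flipH hi U ξ hU hξ h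

/-- ★★ **REDUCTION TO THE FUNDAMENTAL DOMAIN (×4).**  If the hcp dichotomy holds for every self-adjoint positive `U` with `‖U − 1‖ ≤ 1/4` and every `ξ`
with `‖ξ‖ ≤ 1/4`, `0 ≤ ξ₀`, `0 ≤ ξ₂`, it holds for every such `U` and EVERY `ξ` with `‖ξ‖ ≤ 1/4`. [folklore] -/
theorem hcpHalf_of_shufSigned {m : ℝ}
    (h : ∀ (U : E3 →L[ℝ] E3) (ξ : E3), (∀ v w : E3, inner ℝ (U v) w = inner ℝ v (U w)) → (∀ w : E3, 0 ≤ inner ℝ w (U w)) →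
      ‖U - 1‖ ≤ 1 / 4 → ‖ξ‖ ≤ 1 / 4 → 0 ≤ ξ 0 → 0 ≤ ξ 2 → HcpDich m U ξ) :
    ∀ (U : E3 →L[ℝ] E3) (ξ : E3), (∀ v w : E3, inner ℝ (U v) w = inner ℝ v (U w)) → (∀ w : E3, 0 ≤ inner ℝ w (U w)) →
      ‖U - 1‖ ≤ 1 / 4 → ‖ξ‖ ≤ 1 / 4 → HcpDich m U ξ := by
  intro U ξ hsa hpos hU hξ
  -- data of the conjugates
  have cU : ∀ (i : Fin 3) (V : E3 →L[ℝ] E3), (∀ v w : E3, inner ℝ (V v) w = inner ℝ v (V w)) → (∀ w : E3, 0 ≤ inner ℝ w (V w)) → ‖V - 1‖ ≤ 1 / 4 →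
      (∀ v w : E3, inner ℝ (((flipIso i : E3 →L[ℝ] E3).comp (V.comp ((flipIso i).symm : E3 →L[ℝ] E3))) v) w =
        inner ℝ v (((flipIso i : E3 →L[ℝ] E3).comp (V.comp ((flipIso i).symm : E3 →L[ℝ] E3))) w)) ∧
      (∀ w : E3, 0 ≤ inner ℝ w (((flipIso i : E3 →L[ℝ] E3).comp (V.comp ((flipIso i).symm : E3 →L[ℝ] E3))) w)) ∧
      ‖(flipIso i : E3 →L[ℝ] E3).comp (V.comp ((flipIso i).symm : E3 →L[ℝ] E3)) - 1‖ ≤ 1 / 4 :=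
    fun i V hVsa hVpos hV => ⟨conjIso_selfAdjoint (flipIso i) hVsa, conjIso_pos (flipIso i) hVpos, (conjIso_norm_sub_one_le (flipIso i) V).trans hV⟩
  have cξ : ∀ (i : Fin 3) (η : E3), ‖η‖ ≤ 1 / 4 → ‖flipIso i η‖ ≤ 1 / 4 := fun i η hη => by rwa [LinearIsometryEquiv.norm_map]
  have f0 : ∀ η : E3, (flipIso 0 η) 0 = -η 0 ∧ (flipIso 0 η) 2 = η 2 := fun η => by
    refine ⟨by rw [flipIso_apply]; simp, by rw [flipIso_apply]; simp⟩
  have f2 : ∀ η : E3, (flipIso 2 η) 0 = η 0 ∧ (flipIso 2 η) 2 = -η 2 := fun η => by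
    refine ⟨by rw [flipIso_apply]; simp, by rw [flipIso_apply]; simp⟩
  by_cases h2 : 0 ≤ ξ 2
  · by_cases h0 : 0 ≤ ξ 0
    · exact h U ξ hsa hpos hU hξ h0 h2
    · obtain ⟨s1, p1, n1⟩ := cU 0 U hsa hpos hU
      refine hcpDich_of_flip (Or.inl rfl) U ξ hU hξ (h _ _ s1 p1 n1 (cξ 0 ξ hξ) ?_ ?_)
      · rw [(f0 ξ).1]; linarith
      · rw [(f0 ξ).2]; exact h2
  · obtain ⟨s1, p1, n1⟩ := cU 2 U hsa hpos hU
    refine hcpDich_of_flip (Or.inr rfl) U ξ hU hξ ?_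
    by_cases h0 : 0 ≤ ξ 0
    · refine h _ _ s1 p1 n1 (cξ 2 ξ hξ) ?_ ?_
      · rw [(f2 ξ).1]; exact h0
      · rw [(f2 ξ).2]; linarith
    · obtain ⟨s2, p2, n2⟩ := cU 0 _ s1 p1 n1
      refine hcpDich_of_flip (Or.inl rfl) _ _ n1 (cξ 2 ξ hξ) (h _ _ s2 p2 n2 (cξ 0 _ (cξ 2 ξ hξ)) ?_ ?_)
      · rw [(f0 _).1, (f2 ξ).1]; linarith
      · rw [(f0 _).2, (f2 ξ).2]; linarith

/-! ## §6. The verdict over the fundamental domain and the generic tree / search theorems -/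

/-- ★ **SHUFFLE-SIGN PRUNE**: the box has `ξ₀ < 0` or `ξ₂ < 0` throughout — a vacuous leaf on the fundamental domain. -/
def shufOut (c w : (Fin 3 × Fin 3) ⊕ Fin 3 → ℤ) : Bool :=
  decide (c (Sum.inr 0) + w (Sum.inr 0) < 0) || decide (c (Sum.inr 2) + w (Sum.inr 2) < 0)

/-- Soundness of the shuffle-sign prune. [folklore] -/
theorem false_of_shufOut {c w : (Fin 3 × Fin 3) ⊕ Fin 3 → ℤ} (h : shufOut c w = true) {ξ : E3}
    (hξb : ∀ i : Fin 3, |ξ i - (c (Sum.inr i) : ℝ) / SC| ≤ (w (Sum.inr i) : ℝ) / SC) (h0 : 0 ≤ ξ 0) (h2 : 0 ≤ ξ 2) : False := by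
  have hS := SC_pos
  have key : ∀ i : Fin 3, 0 ≤ ξ i → ¬ (c (Sum.inr i) + w (Sum.inr i) < 0) := by
    intro i hle hlt
    have ha := (abs_le.1 (hξb i)).2
    have hlt' : ((c (Sum.inr i) : ℝ) + w (Sum.inr i)) / SC < 0 := div_neg_of_neg_of_pos (by exact_mod_cast hlt) hS
    rw [add_div] at hlt'
    linarith
  simp only [shufOut, Bool.or_eq_true, decide_eq_true_eq] at h
  rcases h with h | h
  · exact key 0 h0 h
  · exact key 2 h2 h

/-- ★ **hcp ENTRY-LEAF VERDICT OVER THE FUNDAMENTAL DOMAIN**: shuffle-sign prune ∨ `entryLeafOKH3R μ` (radial ∨ sharp fit ∨ fit ∨ symmetry ∨ column ∨ (P4)). -/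
def entryLeafOKH3RD (μ : ℤ) (c w : (Fin 3 × Fin 3) ⊕ Fin 3 → ℤ) : Bool := shufOut c w || entryLeafOKH3R μ c w

/-- ★★ **THE hcp HALF FROM ONE TREE VERDICT OVER THE FUNDAMENTAL DOMAIN** (generic verdict, `hver` relativised to `0 ≤ ξ₀`, `0 ≤ ξ₂`): the `hhcp`
hypothesis of `…HomPrunedPolar.homFloor_of_prunedBoxSums_selfAdjoint` verbatim, for every `m` with `2 (m + e_W) SC ≤ μ`. [folklore] -/
theorem hcpHalf_of_entryTreeShuf {m : ℝ} {μ : ℤ} (hμ : 2 * (m + (-(7175 / 10000) + 3 / 400)) * SC ≤ μ)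
    (verdict : ((Fin 3 × Fin 3) ⊕ Fin 3 → ℤ) → ((Fin 3 × Fin 3) ⊕ Fin 3 → ℤ) → Bool)
    (hver : ∀ c w, verdict c w = true → ∀ (U : E3 →L[ℝ] E3) (ξ : E3), (∀ v v' : E3, ⟪U v, v'⟫ = ⟪v, U v'⟫) → ‖U - 1‖ ≤ 1 / 4 →
      (∀ ab : Fin 3 × Fin 3, |(U (EuclideanSpace.single ab.2 (1 : ℝ))) ab.1 - (c (Sum.inl ab) : ℝ) / SC| ≤ (w (Sum.inl ab) : ℝ) / SC) →
      (∀ i : Fin 3, |ξ i - (c (Sum.inr i) : ℝ) / SC| ≤ (w (Sum.inr i) : ℝ) / SC) → 0 ≤ ξ 0 → 0 ≤ ξ 2 →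
      (∀ (M : ℕ) (z : Fin M → E3) (c : Fin M), Function.Injective z →
          Set.range z = {x : E3 | dist x (z c) ≤ 133 / 10 ∧ ∃ a : Fin 3 → ℤ,
            x = z c + latPt U hexFrame a ∨ x = z c + latPt U hexFrame a + U (hcpShift + ξ)} →
          TightNearCap (9 / 5) (3 / 2) z c ∨ ExemptNear (9 / 5) ExRec z c ∨ BadNearCap (9 / 5) (3 / 2) z c) ∨
        (μ : ℝ) / SC ≤ ∑ b ∈ (Fintype.piFinset fun _ : Fin 3 => Finset.Icc (-7 : ℤ) 7).filter (fun b => b ≠ 0), effPot w₄₅ ω₄ (3 / 400) ‖latPt U hexFrame b‖ +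
          ∑ b ∈ (Fintype.piFinset fun _ : Fin 3 => Finset.Icc (-7 : ℤ) 7), effPot w₄₅ ω₄ (3 / 400) ‖latPt U hexFrame b + U (hcpShift + ξ)‖)
    {t : CertTree ((Fin 3 × Fin 3) ⊕ Fin 3)} (h : treeOK verdict t rootCH rootWH = true) :
    ∀ (U : E3 →L[ℝ] E3) (ξ : E3), (∀ v w : E3, inner ℝ (U v) w = inner ℝ v (U w)) → (∀ w : E3, 0 ≤ inner ℝ w (U w)) →
      ‖U - 1‖ ≤ 1 / 4 → ‖ξ‖ ≤ 1 / 4 → HcpDich m U ξ := by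
  refine hcpHalf_of_shufSigned fun U ξ hsa _hpos hU hξ hx0 hx2 => ?_
  have hS := SC_pos
  have hroot : ∀ k, |(Sum.elim (fun ab : Fin 3 × Fin 3 => (U (EuclideanSpace.single ab.2 (1 : ℝ))) ab.1) (fun i : Fin 3 => ξ i) k) -
      (rootCH k : ℝ) / SC| ≤ (rootWH k : ℝ) / SC := by
    intro k
    rcases k with ab | i
    · simpa [rootCH, rootWH, rootW] using mem_root_of_near_one hU ab
    · have h := shuffle_mem_rootCube hξ i
      have e1 : (rootCH (Sum.inr i) : ℝ) / SC = 0 := by simp [rootCH]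
      rw [Sum.elim_inr, e1, show (rootWH (Sum.inr i) : ℝ) / SC = 1 / 4 from rootW_div]
      exact h
  have key := treeOK_sound SC_pos
    (P := fun x : (Fin 3 × Fin 3) ⊕ Fin 3 → ℝ => ∀ (U : E3 →L[ℝ] E3) (ξ : E3), (∀ v v' : E3, ⟪U v, v'⟫ = ⟪v, U v'⟫) → ‖U - 1‖ ≤ 1 / 4 →
      (∀ ab : Fin 3 × Fin 3, (U (EuclideanSpace.single ab.2 (1 : ℝ))) ab.1 = x (Sum.inl ab)) → (∀ i : Fin 3, ξ i = x (Sum.inr i)) →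
      0 ≤ ξ 0 → 0 ≤ ξ 2 →
      (∀ (M : ℕ) (z : Fin M → E3) (c : Fin M), Function.Injective z →
          Set.range z = {x : E3 | dist x (z c) ≤ 133 / 10 ∧ ∃ a : Fin 3 → ℤ,
            x = z c + latPt U hexFrame a ∨ x = z c + latPt U hexFrame a + U (hcpShift + ξ)} →
          TightNearCap (9 / 5) (3 / 2) z c ∨ ExemptNear (9 / 5) ExRec z c ∨ BadNearCap (9 / 5) (3 / 2) z c) ∨
        (μ : ℝ) / SC ≤ ∑ b ∈ (Fintype.piFinset fun _ : Fin 3 => Finset.Icc (-7 : ℤ) 7).filter (fun b => b ≠ 0), effPot w₄₅ ω₄ (3 / 400) ‖latPt U hexFrame b‖ +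
          ∑ b ∈ (Fintype.piFinset fun _ : Fin 3 => Finset.Icc (-7 : ℤ) 7), effPot w₄₅ ω₄ (3 / 400) ‖latPt U hexFrame b + U (hcpShift + ξ)‖)
    verdict (fun c w hv x hx V η hVsa hV1 hVx hηx h0 h2 => hver c w hv V η hVsa hV1 (fun ab => by rw [hVx ab]; exact hx (Sum.inl ab))
      (fun i => by rw [hηx i]; exact hx (Sum.inr i)) h0 h2) t rootCH rootWH h
    (Sum.elim (fun ab : Fin 3 × Fin 3 => (U (EuclideanSpace.single ab.2 (1 : ℝ))) ab.1) (fun i : Fin 3 => ξ i)) hroot U ξ hsa hU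
    (fun _ => rfl) (fun _ => rfl) hx0 hx2
  refine key.imp id fun hfloor => ?_
  have h2 : 2 * (m + (-(7175 / 10000) + 3 / 400)) ≤ (μ : ℝ) / SC := by rw [le_div_iff₀ hS]; exact hμ
  linarith

/-- ★★ The same from ONE SEARCH Boolean (generic domain-relative verdict). [folklore] -/
theorem hcpHalf_of_entrySearchShuf {m : ℝ} {μ : ℤ} (hμ : 2 * (m + (-(7175 / 10000) + 3 / 400)) * SC ≤ μ)
    (verdict : ((Fin 3 × Fin 3) ⊕ Fin 3 → ℤ) → ((Fin 3 × Fin 3) ⊕ Fin 3 → ℤ) → Bool)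
    (hver : ∀ c w, verdict c w = true → ∀ (U : E3 →L[ℝ] E3) (ξ : E3), (∀ v v' : E3, ⟪U v, v'⟫ = ⟪v, U v'⟫) → ‖U - 1‖ ≤ 1 / 4 →
      (∀ ab : Fin 3 × Fin 3, |(U (EuclideanSpace.single ab.2 (1 : ℝ))) ab.1 - (c (Sum.inl ab) : ℝ) / SC| ≤ (w (Sum.inl ab) : ℝ) / SC) →
      (∀ i : Fin 3, |ξ i - (c (Sum.inr i) : ℝ) / SC| ≤ (w (Sum.inr i) : ℝ) / SC) → 0 ≤ ξ 0 → 0 ≤ ξ 2 →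
      (∀ (M : ℕ) (z : Fin M → E3) (c : Fin M), Function.Injective z →
          Set.range z = {x : E3 | dist x (z c) ≤ 133 / 10 ∧ ∃ a : Fin 3 → ℤ,
            x = z c + latPt U hexFrame a ∨ x = z c + latPt U hexFrame a + U (hcpShift + ξ)} →
          TightNearCap (9 / 5) (3 / 2) z c ∨ ExemptNear (9 / 5) ExRec z c ∨ BadNearCap (9 / 5) (3 / 2) z c) ∨
        (μ : ℝ) / SC ≤ ∑ b ∈ (Fintype.piFinset fun _ : Fin 3 => Finset.Icc (-7 : ℤ) 7).filter (fun b => b ≠ 0), effPot w₄₅ ω₄ (3 / 400) ‖latPt U hexFrame b‖ +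
          ∑ b ∈ (Fintype.piFinset fun _ : Fin 3 => Finset.Icc (-7 : ℤ) 7), effPot w₄₅ ω₄ (3 / 400) ‖latPt U hexFrame b + U (hcpShift + ξ)‖)
    {sel : ℕ → ((Fin 3 × Fin 3) ⊕ Fin 3 → ℤ) → ((Fin 3 × Fin 3) ⊕ Fin 3 → ℤ) → (Fin 3 × Fin 3) ⊕ Fin 3} {fuel d : ℕ}
    (h : searchOK verdict sel fuel d rootCH rootWH = true) :
    ∀ (U : E3 →L[ℝ] E3) (ξ : E3), (∀ v w : E3, inner ℝ (U v) w = inner ℝ v (U w)) → (∀ w : E3, 0 ≤ inner ℝ w (U w)) →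
      ‖U - 1‖ ≤ 1 / 4 → ‖ξ‖ ≤ 1 / 4 → HcpDich m U ξ := by
  obtain ⟨t, ht⟩ := exists_tree_of_searchOK verdict sel fuel d rootCH rootWH h
  exact hcpHalf_of_entryTreeShuf hμ verdict hver ht

/-- ★★ **THE hcp HALF FROM ONE SEARCH BOOLEAN with `entryLeafOKH3RD μ`** (fundamental domain ×4, radial prune, sharp fit). [folklore] -/
theorem hcpHalf_of_entrySearchH3RD {m : ℝ} {μ : ℤ} (hμ : 2 * (m + (-(7175 / 10000) + 3 / 400)) * SC ≤ μ)
    {sel : ℕ → ((Fin 3 × Fin 3) ⊕ Fin 3 → ℤ) → ((Fin 3 × Fin 3) ⊕ Fin 3 → ℤ) → (Fin 3 × Fin 3) ⊕ Fin 3} {fuel d : ℕ}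
    (h : searchOK (entryLeafOKH3RD μ) sel fuel d rootCH rootWH = true) :
    ∀ (U : E3 →L[ℝ] E3) (ξ : E3), (∀ v w : E3, inner ℝ (U v) w = inner ℝ v (U w)) → (∀ w : E3, 0 ≤ inner ℝ w (U w)) →
      ‖U - 1‖ ≤ 1 / 4 → ‖ξ‖ ≤ 1 / 4 → HcpDich m U ξ := by
  refine hcpHalf_of_entrySearchShuf hμ (entryLeafOKH3RD μ) (fun c w hv U ξ hsa hU hbox hξ h0 h2 => ?_) h
  simp only [entryLeafOKH3RD, Bool.or_eq_true] at hv
  rcases hv with hv | hv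
  · exact (false_of_shufOut hv hξ h0 h2).elim
  · exact entryLeafOKH3R_sound hv U ξ hsa hU hbox hξ

/-! ## §7. `(H)` from two search Booleans with every reduction and prune in the tree -/

/-- ★★★ **`(H) HomFloor m`** — fcc: `entryLeafOK6R` (fundamental domain ×24, radial, six coordinates); hcp: `entryLeafOKH3RD` (fundamental domain ×4,
radial, sharp fit, nine coordinates); every `m`, `μ` with `2 (m + e_W) SC ≤ μ`, any selectors. [folklore] -/
theorem homFloor_of_entrySearches6R3RD {m : ℝ} {μ : ℤ} (hμ : 2 * (m + (-(7175 / 10000) + 3 / 400)) * SC ≤ μ)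
    {selF : ℕ → (Fin 3 × Fin 3 → ℤ) → (Fin 3 × Fin 3 → ℤ) → Fin 3 × Fin 3} {fuelF dF : ℕ}
    (hF : searchOK (entryLeafOK6R μ) selF fuelF dF rootC rootW = true)
    {selH : ℕ → ((Fin 3 × Fin 3) ⊕ Fin 3 → ℤ) → ((Fin 3 × Fin 3) ⊕ Fin 3 → ℤ) → (Fin 3 × Fin 3) ⊕ Fin 3} {fuelH dH : ℕ}
    (hH : searchOK (entryLeafOKH3RD μ) selH fuelH dH rootCH rootWH = true) : HomFloor m :=
  homFloor_of_prunedBoxSums_selfAdjoint (fccHalf_of_entrySearch6R hμ hF) (hcpHalf_of_entrySearchH3RD hμ hH)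

/-- ★★★ `HomFloor (1/625)` from `entryLeafOK6R muRec` × `entryLeafOKH3RD muRec`. [folklore] -/
theorem homFloor_625_of_entrySearches6R3RD
    {selF : ℕ → (Fin 3 × Fin 3 → ℤ) → (Fin 3 × Fin 3 → ℤ) → Fin 3 × Fin 3} {fuelF dF : ℕ}
    (hF : searchOK (entryLeafOK6R muRec) selF fuelF dF rootC rootW = true)
    {selH : ℕ → ((Fin 3 × Fin 3) ⊕ Fin 3 → ℤ) → ((Fin 3 × Fin 3) ⊕ Fin 3 → ℤ) → (Fin 3 × Fin 3) ⊕ Fin 3} {fuelH dH : ℕ}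
    (hH : searchOK (entryLeafOKH3RD muRec) selH fuelH dH rootCH rootWH = true) : HomFloor (1 / 625) :=
  homFloor_of_entrySearches6R3RD muRec_ok hF hH

/-- ★★★ `HomFloor (1/1000)` from `entryLeafOK6R muMilli` × `entryLeafOKH3RD muMilli`. [folklore] -/
theorem homFloor_milli_of_entrySearches6R3RD
    {selF : ℕ → (Fin 3 × Fin 3 → ℤ) → (Fin 3 × Fin 3 → ℤ) → Fin 3 × Fin 3} {fuelF dF : ℕ}
    (hF : searchOK (entryLeafOK6R muMilli) selF fuelF dF rootC rootW = true)
    {selH : ℕ → ((Fin 3 × Fin 3) ⊕ Fin 3 → ℤ) → ((Fin 3 × Fin 3) ⊕ Fin 3 → ℤ) → (Fin 3 × Fin 3) ⊕ Fin 3} {fuelH dH : ℕ}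
    (hH : searchOK (entryLeafOKH3RD muMilli) selH fuelH dH rootCH rootWH = true) : HomFloor (1 / 1000) :=
  homFloor_of_entrySearches6R3RD muMilli_ok hF hH

/-- ★★★ `HomFloor (1/625)` with EVERY reduction and prune in the tree: fcc `entryLeafOK6RB` (radial ∨ fundamental domain × best fit) × hcp `entryLeafOKH3RD`.
[folklore] -/
theorem homFloor_625_of_entrySearches6RB3RD
    {selF : ℕ → (Fin 3 × Fin 3 → ℤ) → (Fin 3 × Fin 3 → ℤ) → Fin 3 × Fin 3} {fuelF dF : ℕ}
    (hF : searchOK (entryLeafOK6RB muRec) selF fuelF dF rootC rootW = true)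
    {selH : ℕ → ((Fin 3 × Fin 3) ⊕ Fin 3 → ℤ) → ((Fin 3 × Fin 3) ⊕ Fin 3 → ℤ) → (Fin 3 × Fin 3) ⊕ Fin 3} {fuelH dH : ℕ}
    (hH : searchOK (entryLeafOKH3RD muRec) selH fuelH dH rootCH rootWH = true) : HomFloor (1 / 625) :=
  homFloor_of_prunedBoxSums_selfAdjoint (fccHalf_of_entrySearch6RB muRec_ok hF) (hcpHalf_of_entrySearchH3RD muRec_ok hH)

/-- ★★★ `HomFloor (1/1000)` with every reduction and prune. [folklore] -/
theorem homFloor_milli_of_entrySearches6RB3RD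
    {selF : ℕ → (Fin 3 × Fin 3 → ℤ) → (Fin 3 × Fin 3 → ℤ) → Fin 3 × Fin 3} {fuelF dF : ℕ}
    (hF : searchOK (entryLeafOK6RB muMilli) selF fuelF dF rootC rootW = true)
    {selH : ℕ → ((Fin 3 × Fin 3) ⊕ Fin 3 → ℤ) → ((Fin 3 × Fin 3) ⊕ Fin 3 → ℤ) → (Fin 3 × Fin 3) ⊕ Fin 3} {fuelH dH : ℕ}
    (hH : searchOK (entryLeafOKH3RD muMilli) selH fuelH dH rootCH rootWH = true) : HomFloor (1 / 1000) :=
  homFloor_of_prunedBoxSums_selfAdjoint (fccHalf_of_entrySearch6RB muMilli_ok hF) (hcpHalf_of_entrySearchH3RD muMilli_ok hH)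

/-! ## §8. Kernel smoke test -/

/-- The shuffle-sign prune fires on a box with `ξ₀ < 0` throughout and not on the root cube; the combined verdict accepts that box. -/
example : shufOut (Function.update rootCH (Sum.inr 0) (-3000)) (fun _ => 1000) = true ∧ shufOut rootCH rootWH = false ∧
    entryLeafOKH3RD muRec (Function.update rootCH (Sum.inr 0) (-3000)) (fun _ => 1000) = true := by
  decide +kernel

end Summit.AtomisticToContinuum.Crystallization.Theorems.FrustratedLawDichotomyStrainedPatchHomEntryFlipHcp
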